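import Summits.HodgeConjecture.CorCM.HypLiu418.A3Liu418EpsRigidFaceTypes
import Literature.NumberTheory.NumberFields.TotallyPositivePrescribedSquareClass
import HarnessLib

/-!
# Line `a3-liu418`, row III-11: the binder `PrescribedLocalSquareClass` of `epsRigidAtFace_of_localTwist` CLOSED BY NAME

Summits side, `Theorems/` (cell `hodgecm-mathlib`, fan A, rung A-III; crux item stmt-HodgeConjecture-24832 `HypLiu418`, registered residual
`stub_epsRigidAtFace` = row III-11; road memo `A-provers/A-p19/ROAD-III11-v2.md` af743dc36c4b04cf, piece P5).  THEOREMS ONLY, sorry-free.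

A-p19's binder-types file ✔ `CorCM/HypLiu418/A3Liu418EpsRigidFaceTypes.lean` (p611602) states the fourth hypothesis of the III-11 closing theorem
`epsRigidAtFace_of_localTwist (hT : LocalTypeGaloisTwist) (hN : CyclotomicUnitIsLocalNormOdd) (hN₂ : CyclotomicUnitIsLocalNormDyadic)
(hS : PrescribedLocalSquareClass) : EpsRigidAtFace` as the closed Prop
`PrescribedLocalSquareClass := ∀ K v (κ : K_v), Valued.v κ = 1 → ∃ (t : Kˣ) (s : K_vˣ), s · s · t = κ` — «a prescribed local square class of units is
globally represented».  This is A-p12's ✔ `Literature.NumberTheory.NumberFields.exists_totallyPositive_eq_mul_sq` (p610101, weak approximation at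
`{v} ∪ ∞` + «local squares are open», [CasselsFrohlichANT1967, Ch. II §6] + [Omeara1963, 63:1b]) read in the dilation orientation `κ = s² t`
(the global `t` is moreover TOTALLY POSITIVE, which the binder does not ask):

* `prescribedLocalSquareClass_holds : PrescribedLocalSquareClass` — the binder `hS`, UNCONDITIONAL;
* `prescribedLocalSquareClass_totallyPositive` — the same with `t` totally positive (kept for the admissible-index variant of the argument).

HC_CM is proved only modulo the 7 printed citations (`hDel`, `h21`, `hLiu418`, `h411`, `h413`, `hD3`, `hD1''`) until rung 0 closes; this file discharges
none of them (it removes one of the four binders of the III-11 closing theorem, which itself serves the residual `stub_epsRigidAtFace` of `hLiu418`).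

## References
* [CasselsFrohlichANT1967] Ch. II §6 (weak approximation); [Omeara1963] §63A Cor. 63:1b (`F_𝔭²` open).
* [Liu2021] Thm. 4.18 (3), proof l. 2272–2289 (where the cyclotomic unit `χ_cyc(σ)` is compared with local norm classes).
-/

set_option autoImplicit false

noncomputable section

namespace Summit.HodgeConjecture.CorCM.Lines.A3Liu418

open NumberField IsDedekindDomain

/-- **`PrescribedLocalSquareClass` with a TOTALLY POSITIVE representative**: for a number field `K`, a finite place `v` and `κ ∈ K_v` with
`Valued.v κ = 1` there are `t ∈ Kˣ` with `φ(t) > 0` for every `φ : K →+* ℝ` and `s ∈ K_vˣ` with `s · s · t = κ` (✔ `exists_totallyPositive_eq_mul_sq`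
gives `t = κ · s₀²`; take `s = s₀⁻¹`). [cite: CasselsFrohlichANT1967, Ch. II §6 Lemma (weak approximation)] [cite: Omeara1963, §63A Cor. 63:1b] -/
theorem prescribedLocalSquareClass_totallyPositive (K : Type) [Field K] [NumberField K] (v : HeightOneSpectrum (𝓞 K))
    (κ : v.adicCompletion K) (hκ : Valued.v κ = 1) :
    ∃ (t : Kˣ) (s : (v.adicCompletion K)ˣ), (∀ φ : K →+* ℝ, 0 < φ (t : K)) ∧
      (s : v.adicCompletion K) * s * algebraMap K (v.adicCompletion K) ((t : Kˣ) : K) = κ := by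
  have hκ0 : κ ≠ 0 := fun h => by simp [h] at hκ
  obtain ⟨t, s, ht, hts⟩ := Literature.NumberTheory.NumberFields.exists_totallyPositive_eq_mul_sq v (Units.mk0 κ hκ0)
  refine ⟨t, s⁻¹, ht, ?_⟩
  rw [Units.val_mk0] at hts
  rw [hts, Units.val_inv_eq_inv_val]
  field_simp

/-- **Row III-11, binder `hS` CLOSED BY NAME**: `PrescribedLocalSquareClass` holds unconditionally (A-p12 P5a ✔ p610101, dilation orientation).
[cite: CasselsFrohlichANT1967, Ch. II §6 Lemma (weak approximation)] [cite: Omeara1963, §63A Cor. 63:1b] -/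
theorem prescribedLocalSquareClass_holds : PrescribedLocalSquareClass := by
  intro K _ _ v κ hκ
  obtain ⟨t, s, -, h⟩ := prescribedLocalSquareClass_totallyPositive K v κ hκ
  exact ⟨t, s, h⟩

end Summit.HodgeConjecture.CorCM.Lines.A3Liu418

end
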